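import Mathlib
import HarnessLib
import Summits.HubbardSuperconductivity.HubbardSuperconductivity.Theorems.KLProgrammeKLRegimeSplitPredicatesV3
import Summits.HubbardSuperconductivity.HubbardSuperconductivity.Theorems.KLProgrammeKLRegimeSplitPairFrozen
import Summits.HubbardSuperconductivity.HubbardSuperconductivity.Theorems.KLProgrammeKLRegimeSplitRowZeroMajorant

/-!
# Route `KLProgramme` — row 0′ on the V3 bundle: (B1-v2) `PairArrayAt` at scale `n` for EVERY total momentum, from
# `PairLadderStepAtV3` (n = 0 clause for all `Q`) and `PairValueIncrementAt` at the scales `≤ n`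

Cell gate-hubbard-kl, seat p3; the adapter announced in HOME/STATUS 11:56Z for plan g9's V3-R (11:43Z).  `PairLadderStepAtV3` is
`PairLadderStepAt` with the `n = 0` value clause for ALL total momenta, so (`pairLadderStepAt_of_v3`) the V2 theorems
`pairLadder_envelope` / `pairArray_envelope` apply verbatim, and the momenta never in any pair class (`|p_Q|_𝕋 > 1`) are frozen from
scale `0` on (`pairFrozen_increment` with `t = 0`, `u := U`): **`pairArray_envelope_v3`** — for every `Qm`,
`∃ u ∈ [0, U], |𝒞_n(Q;k,k') - u| ≤ 8A_n + (Klam U)²·3CF + Σ_{i<n} ē_i` on the ball — and the packaging **`pairArrayAt_of_ladder_v3`**: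
`PairArrayAt L M P β U μ K n` as soon as that majorant is `≤ P.C_W·U²` (`rowZero_majorant_le` of `…RowZeroMajorant` gives it as
`c(G,P,Q,|U|)·U² + 2Σ CL/L`; child 1's `U₀(Q)` and volume threshold close it).  Everything is proved; no definitions.
-/

noncomputable section

namespace Summit.HubbardSuperconductivity.HubbardSuperconductivity.Theorems.KLRegimeSplit

set_option linter.dupNamespace false -- summit = problem name (single-conjunct summit), D-0017

open Finset Literature.MathematicalPhysics.QuantumLattice Literature.Probability.LatticeModels
open Summit.HubbardSuperconductivity.HubbardSuperconductivity.Theorems.KLProgrammeLegKernels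
open Summit.HubbardSuperconductivity.HubbardSuperconductivity.Theorems.CooperChannelRiccatiFlow

section Model

variable (L M : ℕ) [NeZero L] [NeZero M]

variable {G : GeoConsts} {P : SplitConsts} {Qc : EngConsts}

/-- `PairLadderStepAtV3` is stronger than `PairLadderStepAt` (its `n = 0` clause drops the pair-class restriction). -/
theorem pairLadderStepAt_of_v3 {β U μ : ℝ} {K : TrigPolyC4v} {n : ℕ} (h : PairLadderStepAtV3 L M G P Qc β U μ K n) :
    PairLadderStepAt L M G P Qc β U μ K n :=
  ⟨fun hn Qm _ => h.1 hn Qm, h.2⟩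

/-- **Row 0′ on the V3 bundle, every total momentum.**  From `PairLadderStepAtV3` at all `j ≤ n`, `PairValueIncrementAt` at all
`1 ≤ j ≤ n`, `U ≥ 0` and the two smallness lines: for every `Qm` there is `u ∈ [0, U]` with
`|𝒞_n(Q;k,k') - u| ≤ 8A_n + (Klam U)²·3CF + Σ_{i<n} ē_i` on the ball. -/
theorem pairArray_envelope_v3 (hG : G.WF) (hP : P.WF) (hQc : Qc.WF) {β U μ : ℝ} {K : TrigPolyC4v} (hU : 0 ≤ U) {n : ℕ}
    (hsteps : ∀ j ≤ n, PairLadderStepAtV3 L M G P Qc β U μ K j)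
    (hincr : ∀ j, 1 ≤ j → j ≤ n → PairValueIncrementAt L M G P Qc β U μ K j) (Qm : TorusSite 2 L)
    (hsmall₁ : G.bhi * (U + 8 * (initDevBar G U +
      2 * ∑ j ∈ range n, (drivePBar G P U j + eremBar G P Qc U β L j))) ≤ 1)
    (hsmall₂ : 8 * 16 * (initDevBar G U + 2 * ∑ j ∈ range n, (drivePBar G P U j + eremBar G P Qc U β L j)) *
      (G.bhi * n) ≤ 1) :
    ∃ u : ℝ, 0 ≤ u ∧ u ≤ U ∧ ∀ k ∈ klBall L μ K, ∀ k' ∈ klBall L μ K,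
      ‖klPairAmplitude L M β U μ K n Qm k k' - (u : ℂ)‖ ≤
        8 * (initDevBar G U + 2 * ∑ j ∈ range n, (drivePBar G P U j + eremBar G P Qc U β L j)) +
          ((P.Klam * U) ^ 2 * (3 * G.CF) + ∑ i ∈ range n, eremBar G P Qc U β L i) := by
  by_cases hQ0 : IsPairClassAt L Qm 0
  · exact pairArray_envelope L M hG hP hQc hU (fun j hj => pairLadderStepAt_of_v3 L M (hsteps j hj)) hincr hQ0 hsmall₁ hsmall₂
  · -- never in the pair class: frozen from scale 0, around the bare value U
    have hτ0 : ∀ j, 0 ≤ drivePBar G P U j + eremBar G P Qc U β L j :=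
      fun j => add_nonneg (drivePBar_nonneg' hG U j) (eremBar_nonneg' hG hP hQc U β L j)
    have hinit0 : 0 ≤ initDevBar G U := by
      unfold initDevBar
      refine mul_nonneg (add_nonneg (sum_nonneg fun χ _ => add_nonneg (hG.2.1 χ) (hG.1 χ)) zero_le_one) (sq_nonneg U)
    have hA0 : 0 ≤ initDevBar G U + 2 * ∑ j ∈ range n, (drivePBar G P U j + eremBar G P Qc U β L j) :=
      add_nonneg hinit0 (mul_nonneg (by norm_num) (sum_nonneg fun j _ => hτ0 j))
    have hexit : ((4 : ℝ) ^ (0 + 1))⁻¹ < torusSupNorm (latticeMomentum L Qm 0, latticeMomentum L Qm 1) := by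
      have h1 : ¬ torusSupNorm (latticeMomentum L Qm 0, latticeMomentum L Qm 1) ≤ ((4 : ℝ) ^ 0)⁻¹ := hQ0
      push Not at h1
      refine lt_trans ?_ h1
      norm_num
    refine ⟨U, hU, le_rfl, fun k hk k' hk' => ?_⟩
    have hfro := pairFrozen_increment L M hG hP hQc (Nat.zero_le n) (fun j hj hjn => hincr j (by omega) hjn) hexit k hk k' hk'
    have h0 := (hsteps 0 (Nat.zero_le n)).1 rfl Qm k hk k' hk'
    calc ‖klPairAmplitude L M β U μ K n Qm k k' - (U : ℂ)‖
        ≤ ‖klPairAmplitude L M β U μ K n Qm k k' - klPairAmplitude L M β U μ K 0 Qm k k'‖ +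
            ‖klPairAmplitude L M β U μ K 0 Qm k k' - (U : ℂ)‖ := by
          rw [show klPairAmplitude L M β U μ K n Qm k k' - (U : ℂ) =
            (klPairAmplitude L M β U μ K n Qm k k' - klPairAmplitude L M β U μ K 0 Qm k k') +
              (klPairAmplitude L M β U μ K 0 Qm k k' - (U : ℂ)) by ring]
          exact norm_add_le _ _
      _ ≤ ((P.Klam * U) ^ 2 * (3 * G.CF) + ∑ i ∈ range n, eremBar G P Qc U β L i) + initDevBar G U := add_le_add hfro h0
      _ ≤ _ := by nlinarith [hA0, hinit0, sum_nonneg fun j (_ : j ∈ range n) => hτ0 j]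

/-- **Packaging into (B1-v2)**: if the row-0′ majorant is within `P.C_W·U²`, then `PairArrayAt L M P β U μ K n`. -/
theorem pairArrayAt_of_ladder_v3 (hG : G.WF) (hP : P.WF) (hQc : Qc.WF) {β U μ : ℝ} {K : TrigPolyC4v} (hU : 0 ≤ U) {n : ℕ}
    (hsteps : ∀ j ≤ n, PairLadderStepAtV3 L M G P Qc β U μ K j)
    (hincr : ∀ j, 1 ≤ j → j ≤ n → PairValueIncrementAt L M G P Qc β U μ K j)
    (hsmall₁ : G.bhi * (U + 8 * (initDevBar G U +
      2 * ∑ j ∈ range n, (drivePBar G P U j + eremBar G P Qc U β L j))) ≤ 1)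
    (hsmall₂ : 8 * 16 * (initDevBar G U + 2 * ∑ j ∈ range n, (drivePBar G P U j + eremBar G P Qc U β L j)) *
      (G.bhi * n) ≤ 1)
    (hCW : 8 * (initDevBar G U + 2 * ∑ j ∈ range n, (drivePBar G P U j + eremBar G P Qc U β L j)) +
      ((P.Klam * U) ^ 2 * (3 * G.CF) + ∑ i ∈ range n, eremBar G P Qc U β L i) ≤ P.C_W * U ^ 2) :
    PairArrayAt L M P β U μ K n := by
  intro Qm
  obtain ⟨u, hu0, huU, hu⟩ := pairArray_envelope_v3 L M hG hP hQc hU hsteps hincr Qm hsmall₁ hsmall₂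
  refine ⟨u, hu0, huU.trans (by rw [abs_of_nonneg hU]; linarith), fun k hk k' hk' => (hu k hk k' hk').trans hCW⟩


/-- **Supplier-map row 0′, literally**: the engine bounds `EngineBoundsAtV3` at every scale `j ≤ n` (they carry
`PairLadderStepAtV3 j` and `PairValueIncrementAt j`) give (B1-v2) `PairArrayAt` at `n` — the first conjunct of `BetaSplitAtV3 … n` —
once the regime smallness and the constant choice `majorant ≤ P.C_W·U²` are supplied (child 1's `∃ P`, `∃ c₀`, `∃ U₀`, thresholds;
`rowZero_majorant_le`). -/
theorem pairArrayAt_of_engineBoundsV3 (hG : G.WF) (hP : P.WF) (hQc : Qc.WF) {β U μ : ℝ} {K : TrigPolyC4v} (hU : 0 ≤ U) {n : ℕ}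
    (hE : ∀ j ≤ n, EngineBoundsAtV3 L M G P Qc β U μ K j)
    (hsmall₁ : G.bhi * (U + 8 * (initDevBar G U +
      2 * ∑ j ∈ range n, (drivePBar G P U j + eremBar G P Qc U β L j))) ≤ 1)
    (hsmall₂ : 8 * 16 * (initDevBar G U + 2 * ∑ j ∈ range n, (drivePBar G P U j + eremBar G P Qc U β L j)) *
      (G.bhi * n) ≤ 1)
    (hCW : 8 * (initDevBar G U + 2 * ∑ j ∈ range n, (drivePBar G P U j + eremBar G P Qc U β L j)) +
      ((P.Klam * U) ^ 2 * (3 * G.CF) + ∑ i ∈ range n, eremBar G P Qc U β L i) ≤ P.C_W * U ^ 2) :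
    PairArrayAt L M P β U μ K n :=
  pairArrayAt_of_ladder_v3 L M hG hP hQc hU (fun j hj => (hE j hj).2.2.1) (fun j _ hj => (hE j hj).2.2.2.1) hsmall₁ hsmall₂ hCW


/-- **Row 0′ with the constant chosen**: with the `G,P`-dependent constant
`C := 8((Σ_χ(abot χ + atop χ) + 1) + 2(aplus Klam² Z + cloc Klam² (1-4^{-θ})⁻¹ + 1)) + 3 CF Klam² + cloc Klam² (1-4^{-θ})⁻¹ + 2 ≤ P.C_W`,
the `Q`-dependent smallness `2·CR·Klam³·|U| ≤ 1` (child 1's `U₀(Q)`), the volume threshold `17·Σ_{j<n} CL β j / L ≤ U²` (child 1's `L₁`)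
and the two regime lines, the engine bounds at scales `≤ n` give `PairArrayAt L M P β U μ K n`. -/
theorem pairArrayAt_of_engineBoundsV3_explicit (hG : G.WF) (hP : P.WF) (hQc : Qc.WF) {β U μ : ℝ} {K : TrigPolyC4v} (hU : 0 ≤ U)
    {n : ℕ} (hE : ∀ j ≤ n, EngineBoundsAtV3 L M G P Qc β U μ K j)
    (hsmall₁ : G.bhi * (U + 8 * (initDevBar G U +
      2 * ∑ j ∈ range n, (drivePBar G P U j + eremBar G P Qc U β L j))) ≤ 1)
    (hsmall₂ : 8 * 16 * (initDevBar G U + 2 * ∑ j ∈ range n, (drivePBar G P U j + eremBar G P Qc U β L j)) *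
      (G.bhi * n) ≤ 1)
    (hUCR : 2 * Qc.CR * P.Klam ^ 3 * |U| ≤ 1) (hL : 17 * ∑ j ∈ range n, Qc.CL β j / L ≤ U ^ 2)
    (hCW : 8 * ((∑ χ : D4Irrep, (G.abot χ + G.atop χ) + 1) +
        2 * (G.aplus * P.Klam ^ 2 * G.Z + G.cloc * P.Klam ^ 2 * (1 - (4 : ℝ) ^ (-G.θ))⁻¹ + 1)) +
      3 * G.CF * P.Klam ^ 2 + G.cloc * P.Klam ^ 2 * (1 - (4 : ℝ) ^ (-G.θ))⁻¹ + 2 ≤ P.C_W) :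
    PairArrayAt L M P β U μ K n := by
  refine pairArrayAt_of_engineBoundsV3 L M hG hP hQc hU hE hsmall₁ hsmall₂ ?_
  have hmaj := rowZero_majorant_le (Qc := Qc) hG hP hQc U β L n
  have hsum := eremBar_sum_le hG hP hQc U β L n
  have hU2 : 0 ≤ U ^ 2 := sq_nonneg U
  have hCL0 : 0 ≤ ∑ j ∈ range n, Qc.CL β j / L := sum_nonneg fun j _ => div_nonneg (hQc.2.2.2.2.2.2.2 β j) (Nat.cast_nonneg L)
  have hθ : 0 < G.θ := hG.2.2.2.2.2.1
  have hg : 0 ≤ (1 - (4 : ℝ) ^ (-G.θ))⁻¹ :=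
    inv_nonneg.2 (by have := Real.rpow_lt_one_of_one_lt_of_neg (x := (4 : ℝ)) (by norm_num) (by linarith : -G.θ < 0); linarith)
  have hK0 : 0 ≤ P.Klam := zero_le_one.trans hP.1
  have hcloc : 0 ≤ G.cloc := hG.2.2.2.2.1
  have haplus : 0 ≤ G.aplus := hG.2.2.2.2.2.2.2.2.2.2.1
  have hCF : 0 ≤ G.CF := hG.2.2.2.2.2.2.2.2.2.2.2.2.2.1
  have hCR : 0 ≤ Qc.CR := hQc.2.1
  have hab : 0 ≤ ∑ χ : D4Irrep, (G.abot χ + G.atop χ) := sum_nonneg fun χ _ => add_nonneg (hG.2.1 χ) (hG.1 χ)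
  -- the CR term: `2 CR Klam³ |U| · U² ≤ U²`
  have hCRU : 2 * Qc.CR * P.Klam ^ 3 * |U| * U ^ 2 ≤ U ^ 2 := by nlinarith
  have hK2 : 0 ≤ P.Klam ^ 2 * U ^ 2 := by positivity
  have hZ : 0 ≤ G.Z := le_trans (sum_nonneg fun j _ => hG.2.2.2.2.2.2.2.2.1 j) (hG.2.2.2.2.2.2.2.2.2.1 0)
  nlinarith [hmaj, hsum, hCRU, hL, hCL0, mul_nonneg hcloc hK2, mul_nonneg haplus (mul_nonneg hK2 hZ), mul_nonneg hCF hK2,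
    mul_nonneg hab hU2, mul_nonneg hg (mul_nonneg hcloc hK2), mul_nonneg (mul_nonneg hCR (pow_nonneg hK0 3)) (abs_nonneg U)]

end Model

end Summit.HubbardSuperconductivity.HubbardSuperconductivity.Theorems.KLRegimeSplit

end
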